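/-
Copyright (c) 2026 the pub-hodgecm-mathlib formalisation cell (harness21).  Prover seat hodgecm-mathlib-K2Liu-p02 (g6), Track B «K2-LIT» ∕ hLiu418
#184♮, Road I v3 for #42F′, wave «IK-GLOB» (LEAD F0P6-plan (g13) RULINGS «M-157q»∕«M-157r», DESIGN memo «=» 10:01:51Z), letter (K-a)
«RESTRICTION OF SCALARS IN STANDARD DARBOUX COORDINATES»: ring-generic.
-/
import Literature.NumberTheory.Automorphic.UnitaryGroupSymplecticEmbedding        -- ★ `IsQuadraticCoordinates.resAut`, `resAut_apply_mk`
import Literature.RepresentationTheory.HeisenbergGroup.SymplecticMatrixTransport    -- ★ `darboux`, `transportSp` (`u = (x, T y)`)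
import HarnessLib

/-!
# K2_Liu road (hLiu418 = stmt-HodgeConjecture-24832), wave «IK-GLOB», letter (K-a): the restriction-of-scalars action `resAut g` of an `S`-linear `g`
# READ IN THE STANDARD DARBOUX COORDINATES `u = (x, T y)` of ★ `transportSp` is the block matrix `(P, d·Q·T⁻¹; T·Q, T·P·T⁻¹)`, `g = P + Q δ`

Cell `pub/hodgecm-mathlib` (D-0151), Track B, build stream 29; DESIGN memo `K2/K2Liu-p02/g6/DESIGN-IKGLOB-WprimeKD.K2Liu-p02-g6.md` §2 (K), §4 (E).  The movers
of the Ikeda carrier `𝓡` (RULING M-157q (r1)) are Weil operators `ω(r_F γ)` of RATIONAL symplectic MATRICES `γ` in Mathlib's standard frame (★ `ratThetaLiftCont`,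
★ `transportSp T : Matrix.symplecticGroup ι K →* Sp(K^ι × K^ι, polar β_T)`, `A ↦ P⁻¹ A P`, `P(x, y) = (x, T y)` = ★ `darboux T`), whereas the unitary groups
act through restriction of scalars `S ⊇ R` in the `(re, im)` coordinates (★ `IsQuadraticCoordinates.resAut`, ★ `toSymplectic`, ★ `adelicToSymplectic` —
`toSpD` of the doubled datum).  To conjugate the latter by the former (the κ-conjugation letter ★ p859248 `K2LiuCayleyMoverDeltaFrame`, whose input is a
standard-frame block matrix `R` with `R · E = E · (N 0; N′ M)`) one needs the standard-frame MATRIX of `resAut g`.  This file computes it, ring-generically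
(`R ⊆ S` with quadratic coordinates `(φ, Ψ, δ, d)`, any symmetric `T` with `det T` a unit, any finite index `n`):

* **`darboux_resAut_darboux_symm`** — `darboux T (resAut g (darboux T)⁻¹ u) = (P, d • Q T⁻¹; T Q, T P T⁻¹) · u` with `P = re ∘ g`, `Q = im ∘ g` entrywise
  (★ `resAut_apply_mk`: `resAut g (a, b) = (P a + d·Q b, Q a + P b)`; ★ `darboux_apply`∕`darboux_symm_sumElim`);
* **`darboux_resAut_eq_mulVec`** — the same with `u = darboux T v`: `darboux T (resAut g v) = (…) · darboux T v` — the form `transportSp`'s consumers read.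

USE ((K)∕(E) of IK-GLOB): at the doubled datum `T^𝔻 = e₂ (T₀ ⊕ −T₀) e₂` (★ `gramD`) and `g = h ⊗ 1` (★ `tensorEmb h`, blocks ★ `blk`) resp. `g = 1 ⊗ k` (`k ∈ U(V′)`), this
block matrix, re-enumerated along `e₂ ⊕ e₂`, IS the `R` of ★ `cayleyMoverMatrix_mul_eq_of_deltaStable` ∕ `…_doubledDiagonal`; its `Δ`-stability for `h ∈ P_Δ`
is ★ `IsSiegelDelta` read on `re`∕`im` parts.

No definition, no instance, no notation, no named-fact hypothesis, no `sorry`; axioms ⊆ {propext, Classical.choice, Quot.sound}.  HONEST LABEL: HC_CM is proved only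
modulo the 7 printed citations (2 remaining named inputs: hLiu418 = stmt-HodgeConjecture-24832, h413 = stmt-HodgeConjecture-24833) until rung 0 closes; this file is a
`--supports stmt-HodgeConjecture-24832` helper (wave IK-GLOB, letter (K-a)) and moves no counter.

References: [GelbartRogawski1991] S. Gelbart, J. Rogawski, Invent. Math. 105 (1991), §3.1 p. 454 (`Res_{E∕F}(V ⊗ W)`, the polarisation `Fⁿ·1 ⊕ Fⁿ·δ`);
[MoeglinVignerasWaldspurger1987] LNM 1291, Chap. 2 II.2 (Darboux frames, Siegel Levi and unipotents); [Kudla1994] S. S. Kudla, Israel J. Math. 87 (1994), §2–§3.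
-/

set_option autoImplicit false
set_option linter.dupNamespace false

noncomputable section

open scoped Matrix

namespace Summit.HodgeConjecture.HodgeConjecture.Cruxes.HLiu418.K2LiuResAutDarboux

open Literature.NumberTheory.Automorphic Literature.NumberTheory.Automorphic.UnitaryGroup
open Literature.NumberTheory.Automorphic.UnitaryGroup.QuadraticCoordinates
open Literature.RepresentationTheory.HeisenbergGroup Literature.RepresentationTheory.HeisenbergGroup.SymplecticMatrix

variable {R S : Type*} [CommRing R] [CommRing S]
variable {φ : R →+* S} {Ψ : (R × R) ≃+ S} {δ : S} {d : R} (h : IsQuadraticCoordinates φ Ψ δ d)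
variable {n : Type*} [Fintype n] [DecidableEq n] (T : Matrix n n R) (hT : IsUnit T.det)

/-- **THE STANDARD-DARBOUX MATRIX OF RESTRICTION OF SCALARS.**  For `g ∈ GLₙ(S)` with real blocks `P = re ∘ g`, `Q = im ∘ g` (entrywise through the quadratic
coordinates `Ψ`) and a symmetric Gram matrix `T` with `det T` a unit: in the Darboux coordinates `u = (x, T y)` of ★ `transportSp`,
`darboux T (resAut g (darboux T)⁻¹ u) = (P, d • (Q T⁻¹); T Q, T P T⁻¹) · u`.  (★ `resAut_apply_mk` + ★ `darboux_symm_apply` ∕ `darboux_apply`.)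
[cite: GelbartRogawski1991, §3.1 p. 454] [cite: MoeglinVignerasWaldspurger1987, Chap. 2 II.2] -/
theorem darboux_resAut_darboux_symm (g : GL n S) (u : n ⊕ n → R) :
    darboux T hT (h.resAut n g ((darboux T hT).symm u)) =
      Matrix.fromBlocks ((g : Matrix n n S).map (re Ψ)) (d • ((g : Matrix n n S).map (im Ψ) * T⁻¹))
          (T * (g : Matrix n n S).map (im Ψ)) (T * (g : Matrix n n S).map (re Ψ) * T⁻¹) *ᵥ u := by
  rw [darboux_symm_apply, h.resAut_apply_mk, darboux_apply, Matrix.fromBlocks_mulVec]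
  congr 1 <;> simp only [Matrix.mulVec_add, Matrix.smul_mulVec, Matrix.mulVec_mulVec, Matrix.mul_assoc]

/-- **the same on a general vector `v = (x, y)`**: `darboux T (resAut g v) = (P, d • (Q T⁻¹); T Q, T P T⁻¹) · darboux T v` — so the standard-frame matrix
conjugating into ★ `transportSp T` is this block matrix (the input `R` of ★ `K2LiuCayleyMoverDeltaFrame` at the doubled datum).
[cite: GelbartRogawski1991, §3.1 p. 454] [cite: Kudla1994, §2] -/
theorem darboux_resAut_eq_mulVec (g : GL n S) (v : (n → R) × (n → R)) :
    darboux T hT (h.resAut n g v) =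
      Matrix.fromBlocks ((g : Matrix n n S).map (re Ψ)) (d • ((g : Matrix n n S).map (im Ψ) * T⁻¹))
          (T * (g : Matrix n n S).map (im Ψ)) (T * (g : Matrix n n S).map (re Ψ) * T⁻¹) *ᵥ darboux T hT v := by
  rw [← darboux_resAut_darboux_symm h T hT g (darboux T hT v), LinearEquiv.symm_apply_apply]

end Summit.HodgeConjecture.HodgeConjecture.Cruxes.HLiu418.K2LiuResAutDarboux

end
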